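import Mathlib.Algebra.BigOperators.Fin
import Mathlib.Algebra.Module.BigOperators
import Mathlib.Algebra.Order.BigOperators.Group.Finset
import Mathlib.Algebra.Order.Ring.Abs
import Mathlib.Algebra.Group.Int.Even
import Mathlib.Data.Fintype.BigOperators
import Mathlib.Tactic
import HarnessLib

/-!
# Functions satisfying the cube identity are quadratic: expansion on integer combinations

A function `L : G → Q` between abelian groups with `L 0 = 0` satisfies the **cube identity** if
`L(x+y+z) + L x + L y + L z = L(x+y) + L(x+z) + L(y+z)` for all `x, y, z`. The model is
`L(f) = [f^* 𝓛] ∈ Pic(X)` for homomorphisms `f : X → Y` of abelian varieties and a line bundle `𝓛` on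
`Y` (Mumford, *Abelian Varieties*, §6, Cor. 2 of the theorem of the cube; Görtz–Wedhorn II,
Prop. 27.167), which is how it is used in `Motives/AbelianVarietyEndDegreeBound`. Such an `L` is a
polynomial map of degree `≤ 2`: its polar form `B(x, y) = L(x+y) - L x - L y` is biadditive
(`polar_add_left`), `L(n x) = n L(x) + (n(n-1)/2) B(x, x)` (`apply_zsmul`; cf. Mumford §6 Cor. 3,
`[n]^*𝓛 = 𝓛^{(n²+n)/2} ⊗ [-1]^*𝓛^{(n²-n)/2}`), and consequently (`exists_expansion`) for every finite
family `e : Fin r → G` there are finitely many elements `g_k` (the `eᵢ`, `2eᵢ`, `eᵢ + eⱼ`) and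
integer coefficient functions `c_k` of at most quadratic growth, `|c_k(n)| ≤ C₀ (1 + ∑ |nᵢ|)²`, with
`L(∑ nᵢ eᵢ) = ∑_k c_k(n) L(g_k)` for all `n ∈ ℤ^r`. This expansion — rather than an exact polynomial
formula, which would need division by `2` in `Q` — is what the degree bound of Mumford §19 (proof
of Thm. 3 via Thm. 2) consumes.

Pure algebra; no scheme imports. Mathlib has `QuadraticMap` (quadratic maps of modules, with a
*bilinear* companion over a commutative ring) but not this characterisation of degree-`2` maps of
abelian groups by the cube (second-difference) identity, nor the integer expansion; nothing here
duplicates `QuadraticMap`.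

## References

* D. Mumford, *Abelian Varieties*, TIFR Studies in Mathematics 5, OUP (1970): §6, Cor. 2 and
  Cor. 3 of the theorem of the cube (pp. 58–59). [MumfordAV1970]
* U. Görtz, T. Wedhorn, *Algebraic Geometry II* (2023): Prop. 27.167 (cubical structure) and
  Prop. 27.184 (1). [GortzWedhorn2023]
-/

open Finset

namespace Literature.AlgebraicGeometry.Motives

namespace CubeFunction

variable {G Q : Type*} [AddCommGroup G] [AddCommGroup Q] {L : G → Q}

/-- The polar form `B(x, y) = L(x + y) - L x - L y` of a function satisfying the cube identity
`L(x+y+z) + L x + L y + L z = L(x+y) + L(x+z) + L(y+z)` is additive in the first variable.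
[folklore] -/
theorem polar_add_left
    (hcube : ∀ x y z : G, L (x + y + z) + L x + L y + L z = L (x + y) + L (x + z) + L (y + z))
    (x y z : G) :
    L (x + y + z) - L (x + y) - L z = (L (x + z) - L x - L z) + (L (y + z) - L y - L z) := by
  have h := hcube x y z
  rw [sub_sub, sub_eq_iff_eq_add]
  have : L (x + y + z) = L (x + y) + L (x + z) + L (y + z) - L x - L y - L z := by
    rw [← h]; abel
  rw [this]; abel

/-- The polar form is `ℤ`-linear in the first variable. [folklore] -/
theorem polar_zsmul_left
    (hcube : ∀ x y z : G, L (x + y + z) + L x + L y + L z = L (x + y) + L (x + z) + L (y + z))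
    (h0 : L 0 = 0) (n : ℤ) (x z : G) :
    L (n • x + z) - L (n • x) - L z = n • (L (x + z) - L x - L z) := by
  let φ : G →+ Q :=
    { toFun := fun x => L (x + z) - L x - L z
      map_zero' := by simp [h0]
      map_add' := fun x y => polar_add_left hcube x y z }
  exact map_zsmul φ n x

/-- The polar form is additive in the first variable over finite sums. [folklore] -/
theorem polar_sum_left {ι : Type*} (s : Finset ι)
    (hcube : ∀ x y z : G, L (x + y + z) + L x + L y + L z = L (x + y) + L (x + z) + L (y + z))
    (h0 : L 0 = 0) (x : ι → G) (z : G) :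
    L (∑ i ∈ s, x i + z) - L (∑ i ∈ s, x i) - L z = ∑ i ∈ s, (L (x i + z) - L (x i) - L z) := by
  let φ : G →+ Q :=
    { toFun := fun x => L (x + z) - L x - L z
      map_zero' := by simp [h0]
      map_add' := fun x y => polar_add_left hcube x y z }
  exact map_sum φ x s

/-- `n (n - 1)` is even. [folklore] -/
theorem two_dvd_mul_sub_one (n : ℤ) : 2 ∣ n * (n - 1) := by
  have h := Int.even_mul_succ_self (n - 1)
  rw [sub_add_cancel, mul_comm] at h
  exact even_iff_two_dvd.1 h

/-- `t(n) = n(n-1)/2` satisfies `2 t(n) = n (n - 1)`. [folklore] -/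
theorem two_mul_tri (n : ℤ) : 2 * (n * (n - 1) / 2) = n * (n - 1) :=
  Int.mul_ediv_cancel' (two_dvd_mul_sub_one n)

/-- `t(n + 1) = t(n) + n`. [folklore] -/
theorem tri_succ (n : ℤ) : (n + 1) * (n + 1 - 1) / 2 = n * (n - 1) / 2 + n := by
  have h1 := two_mul_tri (n + 1)
  have h2 := two_mul_tri n
  have : 2 * ((n + 1) * (n + 1 - 1) / 2) = 2 * (n * (n - 1) / 2 + n) := by
    rw [h1, mul_add, h2]; ring
  omega

/-- `|t(n)| ≤ n²`. [folklore] -/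
theorem abs_tri_le (n : ℤ) : |n * (n - 1) / 2| ≤ n ^ 2 := by
  have h2 := two_mul_tri n
  have key : 2 * |n * (n - 1) / 2| ≤ 2 * n ^ 2 := by
    rw [show (2 : ℤ) * |n * (n - 1) / 2| = |2 * (n * (n - 1) / 2)| by
      rw [abs_mul]; norm_num, h2, abs_mul]
    have ha : |n - 1| ≤ |n| + 1 := by
      calc |n - 1| ≤ |n| + |1| := abs_sub _ _
        _ = |n| + 1 := by rw [abs_one]
    have hn : 0 ≤ |n| := abs_nonneg n
    have hsq : |n| ^ 2 = n ^ 2 := sq_abs n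
    nlinarith [mul_le_mul_of_nonneg_left ha hn, abs_nonneg (n - 1)]
  linarith

/-- **`L(n x) = n L(x) + t(n) (L(2x) - 2 L(x))`** with `t(n) = n(n-1)/2`, for a function with
`L 0 = 0` satisfying the cube identity (so that `B(x, x) = L(2x) - 2 L(x)` is its polar form at
`(x, x)`). [folklore] -/
theorem apply_zsmul
    (hcube : ∀ x y z : G, L (x + y + z) + L x + L y + L z = L (x + y) + L (x + z) + L (y + z))
    (h0 : L 0 = 0) (n : ℤ) (x : G) :
    L (n • x) = n • L x + (n * (n - 1) / 2) • (L ((2 : ℤ) • x) - (2 : ℤ) • L x) := by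
  induction n using Int.induction_on with
  | zero => simp [h0]
  | succ n ih =>
    have hB := polar_zsmul_left hcube h0 n x x
    rw [show ((n : ℤ) + 1) • x = (n : ℤ) • x + x by rw [add_zsmul, one_zsmul]]
    have e1 : L ((n : ℤ) • x + x) = L ((n : ℤ) • x) + L x + (n : ℤ) • (L (x + x) - L x - L x) := by
      rw [← hB]; abel
    rw [e1, ih, tri_succ, show x + x = (2 : ℤ) • x from (two_zsmul x).symm]
    module
  | pred n ih =>
    -- from `L(-n x) = L((-n-1) x + x)`
    have hB := polar_zsmul_left hcube h0 (-(n : ℤ) - 1) x x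
    have e0 : (-(n : ℤ) - 1) • x + x = (-(n : ℤ)) • x := by
      rw [sub_smul, one_smul, sub_add_cancel]
    rw [e0] at hB
    have e1 : L ((-(n : ℤ) - 1) • x) =
        L ((-(n : ℤ)) • x) - L x - (-(n : ℤ) - 1) • (L (x + x) - L x - L x) := by
      rw [← hB]; abel
    have ht : (-(n : ℤ) - 1) * (-(n : ℤ) - 1 - 1) / 2 =
        (-(n : ℤ)) * (-(n : ℤ) - 1) / 2 - (-(n : ℤ) - 1) := by
      have := tri_succ (-(n : ℤ) - 1)
      rw [show -(n : ℤ) - 1 + 1 = -(n : ℤ) by ring] at this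
      linarith
    rw [e1, ih, ht, show x + x = (2 : ℤ) • x from (two_zsmul x).symm]
    module

/-- The polar form is additive in the second variable over finite sums. [folklore] -/
theorem polar_sum_right {ι : Type*} (s : Finset ι)
    (hcube : ∀ x y z : G, L (x + y + z) + L x + L y + L z = L (x + y) + L (x + z) + L (y + z))
    (h0 : L 0 = 0) (z : G) (x : ι → G) :
    L (z + ∑ i ∈ s, x i) - L z - L (∑ i ∈ s, x i) = ∑ i ∈ s, (L (z + x i) - L z - L (x i)) := by
  have h := polar_sum_left s hcube h0 x z
  rw [add_comm] at h
  rw [show L (z + ∑ i ∈ s, x i) - L z - L (∑ i ∈ s, x i) =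
      L (z + ∑ i ∈ s, x i) - L (∑ i ∈ s, x i) - L z by abel, h]
  refine Finset.sum_congr rfl fun i _ => ?_
  rw [add_comm (x i) z]; abel

/-- The polar form is `ℤ`-linear in the second variable. [folklore] -/
theorem polar_zsmul_right
    (hcube : ∀ x y z : G, L (x + y + z) + L x + L y + L z = L (x + y) + L (x + z) + L (y + z))
    (h0 : L 0 = 0) (n : ℤ) (z x : G) :
    L (z + n • x) - L z - L (n • x) = n • (L (z + x) - L z - L x) := by
  have h := polar_zsmul_left hcube h0 n x z
  rw [add_comm] at h
  rw [show L (z + n • x) - L z - L (n • x) = L (z + n • x) - L (n • x) - L z by abel, h,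
    add_comm x z]
  congr 1; abel

/-- **Quadratic expansion of a cube function on integer combinations.** For `L : G → Q` with
`L 0 = 0` satisfying the cube identity and a finite family `e : Fin r → G` there are a finite
family `g` of elements of `G` (the `eᵢ`, `2 eᵢ`, `eᵢ + eⱼ`), integer coefficient functions `c_k`
and a constant `C₀` with `|c_k(n)| ≤ C₀ (1 + ∑ |nᵢ|)²` and
`L(∑ nᵢ eᵢ) = ∑_k c_k(n) L(g_k)` for all `n ∈ ℤ^r` — the statement "`L` is a polynomial function
of degree `≤ 2` on `ℤ^r`" in the form needed for bounds. [folklore] -/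
theorem exists_expansion
    (hcube : ∀ x y z : G, L (x + y + z) + L x + L y + L z = L (x + y) + L (x + z) + L (y + z))
    (h0 : L 0 = 0) (r : ℕ) (e : Fin r → G) :
    ∃ (ι : Type) (_ : Fintype ι) (g : ι → G) (c : (Fin r → ℤ) → ι → ℤ) (C₀ : ℕ),
      (∀ (n : Fin r → ℤ) (k : ι), |c n k| ≤ C₀ * (1 + ∑ i, |n i|) ^ 2) ∧
      ∀ n : Fin r → ℤ, L (∑ i, n i • e i) = ∑ k, c n k • L (g k) := by
  induction r with
  | zero =>
    refine ⟨Empty, inferInstance, Empty.elim, fun _ k => k.elim, 0, fun _ k => k.elim, fun n => ?_⟩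
    simp [h0]
  | succ r ih =>
    obtain ⟨ι, _, g, c, C₀, hc, hL⟩ := ih fun i => e i.castSucc
    set u := e (Fin.last r) with hu
    -- the polar identities we need
    let t : ℤ → ℤ := fun a => a * (a - 1) / 2
    -- new family
    let g' : ι ⊕ (Bool ⊕ (Fin r ⊕ Fin r)) → G :=
      Sum.elim g (Sum.elim (fun b => if b then u else (2 : ℤ) • u)
        (Sum.elim (fun i => e i.castSucc + u) (fun i => e i.castSucc)))
    let c' : (Fin (r + 1) → ℤ) → ι ⊕ (Bool ⊕ (Fin r ⊕ Fin r)) → ℤ := fun n =>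
      Sum.elim (c fun i => n i.castSucc)
        (Sum.elim
          (fun b => if b then n (Fin.last r) - 2 * t (n (Fin.last r)) -
              n (Fin.last r) * ∑ i : Fin r, n i.castSucc
            else t (n (Fin.last r)))
          (Sum.elim (fun i => n (Fin.last r) * n i.castSucc)
            (fun i => -(n (Fin.last r) * n i.castSucc))))
    refine ⟨ι ⊕ (Bool ⊕ (Fin r ⊕ Fin r)), inferInstance, g', c', C₀ + 4, ?_, ?_⟩
    · -- bounds
      intro n k
      set a := n (Fin.last r) with ha
      set S' := ∑ i : Fin r, |n i.castSucc| with hS'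
      set S := ∑ i : Fin (r + 1), |n i| with hS
      have hSS' : S = S' + |a| := by rw [hS, Fin.sum_univ_castSucc]
      have hS'0 : 0 ≤ S' := Finset.sum_nonneg fun i _ => abs_nonneg _
      have ha0 : 0 ≤ |a| := abs_nonneg a
      have haS : |a| ≤ S := by rw [hSS']; linarith
      have hS'S : S' ≤ S := by rw [hSS']; linarith
      have hS0 : 0 ≤ S := by linarith
      have hsum : |∑ i : Fin r, n i.castSucc| ≤ S' := Finset.abs_sum_le_sum_abs _ _
      have hni : ∀ i : Fin r, |n i.castSucc| ≤ S' := fun i =>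
        Finset.single_le_sum (f := fun i => |n i.castSucc|) (fun i _ => abs_nonneg _)
          (Finset.mem_univ i)
      have ht : |t a| ≤ a ^ 2 := abs_tri_le a
      have ha2 : a ^ 2 = |a| ^ 2 := (sq_abs a).symm
      have hC : (C₀ : ℤ) * (1 + S') ^ 2 ≤ (C₀ : ℤ) * (1 + S) ^ 2 := by
        apply mul_le_mul_of_nonneg_left _ (Nat.cast_nonneg _)
        nlinarith
      have h4 : (4 : ℤ) * (1 + S) ^ 2 ≤ ((C₀ + 4 : ℕ) : ℤ) * (1 + S) ^ 2 := by
        apply mul_le_mul_of_nonneg_right _ (sq_nonneg _)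
        push_cast; linarith
      have hC' : (C₀ : ℤ) * (1 + S) ^ 2 ≤ ((C₀ + 4 : ℕ) : ℤ) * (1 + S) ^ 2 := by
        apply mul_le_mul_of_nonneg_right _ (sq_nonneg _)
        push_cast; linarith
      rcases k with k | (b | (i | i))
      · -- old coefficients
        exact ((hc _ k).trans hC).trans hC'
      · cases b
        · -- `t a`
          change |t a| ≤ _
          refine le_trans ?_ h4
          nlinarith
        · -- `a - 2 t a - a s`
          change |a - 2 * t a - a * ∑ i : Fin r, n i.castSucc| ≤ _
          refine le_trans ?_ h4
          have h1 : |a - 2 * t a - a * ∑ i : Fin r, n i.castSucc| ≤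
              |a| + 2 * |t a| + |a| * |∑ i : Fin r, n i.castSucc| := by
            have e1 := abs_sub (a - 2 * t a) (a * ∑ i : Fin r, n i.castSucc)
            have e2 := abs_sub a (2 * t a)
            rw [abs_mul] at e1
            rw [abs_mul, abs_two] at e2
            linarith
          have h2 : |a| * |∑ i : Fin r, n i.castSucc| ≤ S * S :=
            mul_le_mul haS (hsum.trans hS'S) (abs_nonneg _) hS0
          nlinarith
      · change |a * n i.castSucc| ≤ _
        refine le_trans ?_ h4
        rw [abs_mul]
        have := mul_le_mul haS ((hni i).trans hS'S) (abs_nonneg _) hS0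
        nlinarith
      · change |-(a * n i.castSucc)| ≤ _
        refine le_trans ?_ h4
        rw [abs_neg, abs_mul]
        have := mul_le_mul haS ((hni i).trans hS'S) (abs_nonneg _) hS0
        nlinarith
    · -- the identity
      intro n
      set a := n (Fin.last r) with ha
      set f' := ∑ i : Fin r, n i.castSucc • e i.castSucc with hf'
      have hsplit : ∑ i : Fin (r + 1), n i • e i = f' + a • u := by
        rw [Fin.sum_univ_castSucc]
      -- `L(f' + a u) = L f' + L (a u) + B(f', a u)`
      have hB1 : L (f' + a • u) - L f' - L (a • u) = a • (L (f' + u) - L f' - L u) :=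
        polar_zsmul_right hcube h0 a f' u
      have hB2 : L (f' + u) - L f' - L u =
          ∑ i : Fin r, (L (n i.castSucc • e i.castSucc + u) - L (n i.castSucc • e i.castSucc) - L u) := by
        rw [hf']; exact polar_sum_left _ hcube h0 _ u
      have hB3 : ∀ i : Fin r, L (n i.castSucc • e i.castSucc + u) - L (n i.castSucc • e i.castSucc) - L u
          = n i.castSucc • (L (e i.castSucc + u) - L (e i.castSucc) - L u) := fun i =>
        polar_zsmul_left hcube h0 _ _ u
      have hLa : L (a • u) = a • L u + t a • (L ((2 : ℤ) • u) - (2 : ℤ) • L u) :=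
        apply_zsmul hcube h0 a u
      have hLf' : L f' = ∑ k, c (fun i => n i.castSucc) k • L (g k) := hL _
      -- assemble
      rw [hsplit]
      have e1 : L (f' + a • u) = L f' + L (a • u) + a • (L (f' + u) - L f' - L u) := by
        rw [← hB1]; abel
      rw [e1, hB2, Finset.sum_congr rfl fun i _ => hB3 i, hLa, hLf']
      -- the right-hand side over the sum type
      simp only [Fintype.sum_sum_type, Fintype.sum_bool, g', c', Sum.elim_inl, Sum.elim_inr,
        if_true, if_false, Bool.false_eq_true]
      simp only [smul_sub, Finset.smul_sum, Finset.sum_sub_distrib, sub_smul, neg_smul,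
        Finset.sum_neg_distrib, smul_smul]
      rw [← Finset.sum_smul, ← Finset.mul_sum]
      module


end CubeFunction

end Literature.AlgebraicGeometry.Motives
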